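import Mathlib
import Literature.NumberTheory.Automorphic.AutomorphicRepsGL
import Literature.NumberTheory.Automorphic.LeviConstantTermIdeal
import Literature.NumberTheory.Automorphic.CuspidalRepDataOfCuspFormInfChar
import Literature.NumberTheory.Automorphic.HarishChandraGLExistence
import HarnessLib

/-!
# Regular algebraic representations: the generators of `Z(𝔤)` act by countably many scalars
# (stub `stub_B1` of line `BaireSketch`, crux `HeckeEigenvalueField`, stmt-Langlands-13632)

For the finitely many generators `g i` of `Z(𝔤𝔩_n(K_∞)) = centerU (archGroupGL n K)` of
`exists_generators_centerU` (each the image at a real or complex place `w` of a central element `z`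
of `U(𝔤𝔩_n(ℝ))` resp. `U(𝔤𝔩_n(ℂ))`) and every regular algebraic automorphic representation
`π = W / W'` of `GL_n(𝔸_K)`, the generator `g i` acts on `W` modulo `W'` by the scalar
`γ(z)(l)`, where `γ` is the Harish-Chandra homomorphism at the place `w` (`harishChandraHomGL`) and
`l` enumerates the archimedean parameter of `π` at the embeddings above `w` (the parameter pins the
central character place by place, `HasArchParameter`, `HasHCParameter`; `Z(𝔤)` acts on `W / W'`
through its word action on `W`, `lift_lieRep_comp_mkQ`, `coe_lift_lieRepW_freeToEnveloping`).
Since the parameter of a regular algebraic (indeed of a C-algebraic) `π` consists of numbers in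
`ℤ + (n-1)/2`, the possible scalar vectors form a countable set. Clozel 1990, §3.3–3.5;
Borel–Jacquet 1979, 4.6; Knapp 2002, Thm. 5.44. [folklore]

Typing note. The Lie algebra actions `π.lieRepW`, `π.lieRep` of the tree are typed on
`(AutomorphyDatum.gl n K hcpt).arch` (definitionally `archGroupGL n K`); the generators and the
words of the registered statement are typed on `archGroupGL n K`. The general lemma
`applyFree_sub_smul_mem_of_hasCentralCharacter` is stated in the first typing, and the passage to
the second happens once, by definitional unfolding, in `applyFree_sub_smul_mem_of_place`. The
commutator Lie structures on matrix algebras and on `Module.End` (Mathlib's non-instance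
`LieRing.ofAssociativeRing`) are never synthesized here: they are read off the types of the tree's
maps (`matToLie`, `mapMatrixLie`, `π.lieRep`) by unification, whence the explicit `(_)` arguments
and the implicit (non-instance) binders `{_ : LieRing H} {_ : LieAlgebra ℝ H}`.
-/

set_option linter.dupNamespace false -- project-wide option; `Summit.Langlands.Langlands` is the mandated namespace

noncomputable section

open scoped Classical
open Literature.NumberTheory.Automorphic NumberField NumberField.mixedEmbedding IsDedekindDomain
  UniversalEnvelopingAlgebra

namespace Summit.Langlands.Langlands.Theorems.HeckeEigenvalueField.Baire

variable {n : ℕ} {K : Type} [Field K] [NumberField K]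

/-- A multiset of `n` complex numbers lying in `r + ℤ` is `{e i + r}_{i : Fin n}` for an integer
vector `e`. [folklore] -/
theorem exists_int_enum {s : Multiset ℂ} (hs : Multiset.card s = n) (r : ℂ)
    (h : ∀ x ∈ s, ∃ k : ℤ, x = k + r) :
    ∃ e : Fin n → ℤ, Finset.univ.val.map (fun i => (e i : ℂ) + r) = s := by
  -- an enumeration of `s` (as in `exists_univ_val_map_eq` of `ShintaniWhittakerFormula`)
  obtain ⟨l, hl⟩ : ∃ l : Fin n → ℂ, Finset.univ.val.map l = s := by
    have hl : s.toList.length = n := by rw [Multiset.length_toList, hs]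
    subst hl
    exact ⟨s.toList.get, by rw [Fin.univ_val_map, List.ofFn_get, Multiset.coe_toList]⟩
  have hmem : ∀ i, l i ∈ s := fun i => hl ▸ Multiset.mem_map_of_mem l (Finset.mem_univ_val i)
  choose e he using fun i => h (l i) (hmem i)
  refine ⟨e, ?_⟩
  rw [← hl]
  exact Multiset.map_congr rfl fun i _ => (he i).symm

/-- **A central character of a sub-Lie-algebra `𝔥 → 𝔤`, read on `W` modulo `W'`.** Let
`π = W / W'` be an automorphic representation datum of `GL_n(𝔸_K)`, `F : 𝔥 → 𝔤 = 𝔤𝔩_n(K_∞)` a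
morphism of real Lie algebras with induced map `Φ : U(𝔥) → U(𝔤)`, and suppose `Z(𝔥)` acts on
`W / W'` (through `π.lieRep ∘ F`) by the character `θ`. Then for every `z ∈ Z(𝔥)` and every word
`p` representing `Φ z`, `p w - θ(z) w ∈ W'` for all `w ∈ W`: `U(𝔥)` acts on `W / W'` through its
action on `W` (`lift_lieRep_comp_mkQ`), which on functions is the word action
(`coe_lift_lieRepW_freeToEnveloping`). Borel–Jacquet 1979, 4.6. [folklore] -/
theorem applyFree_sub_smul_mem_of_hasCentralCharacter {hcpt : isCompact_glFiniteIntegralLevel n K}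
    (π : AutomorphicRepData (AutomorphyDatum.gl n K hcpt)) {H : Type*} {_ : LieRing H}
    {_ : LieAlgebra ℝ H} (F : H →ₗ⁅ℝ⁆ (AutomorphyDatum.gl n K hcpt).arch.lie)
    (Φ : UniversalEnvelopingAlgebra ℝ H →ₐ[ℝ]
      UniversalEnvelopingAlgebra ℝ (AutomorphyDatum.gl n K hcpt).arch.lie)
    (hΦ : ∀ X : H, Φ (ι ℝ X) = ι ℝ (F X))
    {θ : Subalgebra.center ℝ (UniversalEnvelopingAlgebra ℝ H) →ₐ[ℝ] ℂ}
    (hθ : HasCentralCharacter (@LieHom.comp ℝ H _ _ _ _ _ _ _ (_) (_) π.lieRep F) θ)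
    (z : Subalgebra.center ℝ (UniversalEnvelopingAlgebra ℝ H))
    {p : FreeAlgebra ℝ (AutomorphyDatum.gl n K hcpt).arch.lie}
    (hp : freeToEnveloping (AutomorphyDatum.gl n K hcpt).arch p = Φ z)
    {v : (AdelicGroupData.gl n K).Adelic → ℂ} (hv : v ∈ π.W) :
    applyFree (AutomorphyDatum.gl n K hcpt).ofArch p v - θ z • v ∈ π.W' := by
  -- `U(𝔥)` acts on `W` through `Φ`
  have hnat : (lift ℝ π.lieRepW).comp Φ =
      lift ℝ (@LieHom.comp ℝ H _ _ _ _ _ _ _ (_) (_) π.lieRepW F) := by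
    refine @UniversalEnvelopingAlgebra.hom_ext ℝ H _ _ _ (Module.End ℂ π.W) _ _ _ _
      (DFunLike.ext _ _ fun X => ?_)
    simp only [LieHom.coe_comp, Function.comp_apply, AlgHom.coe_toLieHom, AlgHom.coe_comp, hΦ,
      lift_ι_apply]
  have hW : ∀ x : π.W, lift ℝ π.lieRepW (Φ z) x =
      lift ℝ (@LieHom.comp ℝ H _ _ _ _ _ _ _ (_) (_) π.lieRepW F)
        (z : UniversalEnvelopingAlgebra ℝ H) x := by
    intro x
    rw [← hnat]
    rfl
  -- on `W / W'` the element `z` acts by `θ z`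
  have hq :=
    AutomorphicRepData.lift_lieRep_comp_mkQ F π (z : UniversalEnvelopingAlgebra ℝ H) ⟨v, hv⟩
  have hmk : π.mkQ (lift ℝ π.lieRepW (Φ z) ⟨v, hv⟩ - θ z • ⟨v, hv⟩) = 0 := by
    rw [map_sub, map_smul, hW, ← hq, hθ z, Module.algebraMap_end_apply, sub_self]
  have hmem : lift ℝ π.lieRepW (Φ z) ⟨v, hv⟩ - θ z • ⟨v, hv⟩ ∈ π.kerQuot :=
    (Submodule.Quotient.mk_eq_zero π.kerQuot).1 hmk
  have hmem' : ((lift ℝ π.lieRepW (Φ z) ⟨v, hv⟩ : π.W) : (AdelicGroupData.gl n K).Adelic → ℂ) -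
      θ z • v ∈ π.W' := hmem
  rw [← hp, π.coe_lift_lieRepW_freeToEnveloping p ⟨v, hv⟩] at hmem'
  exact hmem'

/-- **The same at a place.** For a coefficient map `f : A → K_∞` (`A = ℝ` or `ℂ`, `f` the inclusion
of a factor), if `Z(𝔤𝔩_n(A))` acts on `W / W'` through `𝔤𝔩_n(A) → 𝔤𝔩_n(K_∞)` (entrywise `f`) by
the character `θ`, then every word representing the image `envOfMat (mapU f z)` of a central
`z ∈ U(𝔤𝔩_n(A))` acts on `W` by `θ z` modulo `W'`. Borel–Jacquet 1979, 4.6; Clozel 1990, §3.3.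
[folklore] -/
theorem applyFree_sub_smul_mem_of_place {hcpt : isCompact_glFiniteIntegralLevel n K}
    (π : AutomorphicRepData (AutomorphyDatum.gl n K hcpt)) {A : Type*} [CommRing A] [Algebra ℝ A]
    (f : A →ₙₐ[ℝ] mixedSpace K) {θ}
    (hθ : @HasCentralCharacter _ (_) (_) _ _ _
      (@LieHom.comp ℝ _ _ _ _ (_) (_) _ _ (_) (_) π.lieRep
        (@LieHom.comp ℝ _ _ _ _ (_) (_) (_) (_) _ _ (matToLie K n) (mapMatrixLie f))) θ)
    {p : FreeAlgebra ℝ (archGroupGL n K).lie} {z}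
    (hp : freeToEnveloping (archGroupGL n K) p = envOfMat K n (HCLevi.mapU f n z))
    (hz : z ∈ Subalgebra.center ℝ _) {v : (AdelicGroupData.gl n K).Adelic → ℂ} (hv : v ∈ π.W) :
    applyFree (AutomorphyDatum.gl n K hcpt).ofArch p v - θ ⟨z, hz⟩ • v ∈ π.W' :=
  applyFree_sub_smul_mem_of_hasCentralCharacter π
    (@LieHom.comp ℝ _ _ _ _ (_) (_) (_) (_) _ _ (matToLie K n) (mapMatrixLie f))
    ((envOfMat K n).comp (HCLevi.mapU f n))
    (fun X => (congrArg (envOfMat K n) (HCLevi.mapU_ι X)).trans (envOfMat_ι _)) hθ ⟨z, hz⟩ hp hv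

/-- **At a real place.** If `π` has archimedean parameter `χ` and `l` enumerates `χ σ_w` at the
real place `w`, then every word representing the image in `Z(𝔤𝔩_n(K_∞))` of a central
`z ∈ U(𝔤𝔩_n(ℝ))` at `w` acts on `W` modulo `W'` by `γ(z)(l)`, `γ` the Harish-Chandra homomorphism
of `𝔤𝔩_n(ℝ)`. Clozel 1990, §3.3; Knapp 2002, Thm. 5.44. [folklore] -/
theorem applyFree_sub_smul_mem_realPlace {hcpt : isCompact_glFiniteIntegralLevel n K}
    (π : AutomorphicRepData (AutomorphyDatum.gl n K hcpt)) {χ : (K →+* ℂ) → Multiset ℂ}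
    (hχ : π.HasArchParameter χ) (w : {w : InfinitePlace K // w.IsReal}) {l : Fin n → ℂ}
    (hl : Finset.univ.val.map l = χ w.1.embedding)
    {p : FreeAlgebra ℝ (archGroupGL n K).lie} {z}
    (hp : freeToEnveloping (archGroupGL n K) p = envOfMat K n (HCLevi.mapU (realPlaceHom w) n z))
    (hz : z ∈ Subalgebra.center ℝ _) {v : (AdelicGroupData.gl n K).Adelic → ℂ} (hv : v ∈ π.W) :
    applyFree (AutomorphyDatum.gl n K hcpt).ofArch p v -
      MvPolynomial.aeval (fun q : (ℝ →ₐ[ℝ] ℂ) × Fin n => l q.2)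
        ((harishChandraHomGL ℝ n).toAlgHom ⟨z, hz⟩) • v ∈ π.W' := by
  obtain ⟨ρ, hρ, hreal, -⟩ := hχ
  obtain rfl : ρ = π.lieRep := π.hasLieAction_unique hρ π.hasLieAction_lieRep
  obtain ⟨-, θ, hθ, hγ⟩ := hreal w
  have h := applyFree_sub_smul_mem_of_place π (realPlaceHom w) hθ hp hz hv
  rw [hγ (harishChandraHomGL ℝ n) (fun _ => l) (fun _ => hl) ⟨z, hz⟩] at h
  exact h

/-- **At a complex place.** If `π` has archimedean parameter `χ` and `l τ` enumerates
`χ (τ ∘ σ_w)` for the two real-algebra embeddings `τ` of `ℂ` at the complex place `w`, then every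
word representing the image in `Z(𝔤𝔩_n(K_∞))` of a central `z ∈ U(𝔤𝔩_n(ℂ))` at `w` acts on `W`
modulo `W'` by `γ(z)(l)`, `γ` the Harish-Chandra homomorphism of `𝔤𝔩_n(ℂ)` (as a real Lie
algebra). Clozel 1990, §3.3; Knapp 2002, Thm. 5.44 and §VI.1. [folklore] -/
theorem applyFree_sub_smul_mem_complexPlace {hcpt : isCompact_glFiniteIntegralLevel n K}
    (π : AutomorphicRepData (AutomorphyDatum.gl n K hcpt)) {χ : (K →+* ℂ) → Multiset ℂ}
    (hχ : π.HasArchParameter χ) (w : {w : InfinitePlace K // w.IsComplex})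
    {l : (ℂ →ₐ[ℝ] ℂ) → Fin n → ℂ}
    (hl : ∀ τ : ℂ →ₐ[ℝ] ℂ, Finset.univ.val.map (l τ) = χ (τ.toRingHom.comp w.1.embedding))
    {p : FreeAlgebra ℝ (archGroupGL n K).lie} {z}
    (hp : freeToEnveloping (archGroupGL n K) p = envOfMat K n (HCLevi.mapU (complexPlaceHom w) n z))
    (hz : z ∈ Subalgebra.center ℝ _) {v : (AdelicGroupData.gl n K).Adelic → ℂ} (hv : v ∈ π.W) :
    applyFree (AutomorphyDatum.gl n K hcpt).ofArch p v -
      MvPolynomial.aeval (fun q : (ℂ →ₐ[ℝ] ℂ) × Fin n => l q.1 q.2)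
        ((harishChandraHomGL ℂ n).toAlgHom ⟨z, hz⟩) • v ∈ π.W' := by
  obtain ⟨ρ, hρ, -, hcomplex⟩ := hχ
  obtain rfl : ρ = π.lieRep := π.hasLieAction_unique hρ π.hasLieAction_lieRep
  obtain ⟨-, θ, hθ, hγ⟩ := hcomplex w
  have h := applyFree_sub_smul_mem_of_place π (complexPlaceHom w) hθ hp hz hv
  rw [hγ (harishChandraHomGL ℂ n) l hl ⟨z, hz⟩] at h
  exact h

/-- **(B1) Regular algebraic ⇒ the generators of `Z(𝔤)` act by pinned scalars.** There are
finitely many generators `g i` of `Z(𝔤𝔩_n(K_∞)) = centerU (archGroupGL n K)`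
(`exists_generators_centerU`: images at the archimedean places of central elements of
`U(𝔤𝔩_n(ℝ))`, `U(𝔤𝔩_n(ℂ))`) and a COUNTABLE set `C₀` of scalar vectors such that for every regular
algebraic automorphic representation `π = W / W'` of `GL_n(𝔸_K)` some `c ∈ C₀` gives the action of
every `g i` on `W` modulo `W'`: for every word `p` representing `g i`, `p w - c i • w ∈ W'` for all
`w ∈ W` (the infinity type pins, place by place, the central character of `W / W'` through the
Harish-Chandra homomorphism `harishChandraHomGL` (`nonempty_harishChandraHomGL_holds`), and `Z(𝔤)`
acts on `W / W'` through its word action on `W`, `coe_lift_lieRepW_freeToEnveloping`,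
`lift_lieRep_comp_mkQ`;
regular algebraic weights are `ℤ + (n-1)/2`-valued, whence countability: `C₀` is the image of the
integer vectors `(K →+* ℂ) → Fin n → ℤ`). Clozel 1990, §3.3–3.5; Borel–Jacquet 1979, 4.6.
[folklore] -/
theorem stub_B1 (hcpt : isCompact_glFiniteIntegralLevel n K) :
    ∃ (ι₀ : Type) (_ : Fintype ι₀) (g : ι₀ → centerU (archGroupGL n K)) (C₀ : Set (ι₀ → ℂ)),
      Algebra.adjoin ℝ (Set.range g) = ⊤ ∧ C₀.Countable ∧
      ∀ (π : AutomorphicRepData (AutomorphyDatum.gl n K hcpt)), π.IsRegularAlgebraic →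
        ∃ c ∈ C₀, ∀ (i : ι₀) (p : FreeAlgebra ℝ (archGroupGL n K).lie),
          freeToEnveloping (archGroupGL n K) p =
            ((g i : centerU (archGroupGL n K)) : UniversalEnvelopingAlgebra ℝ (archGroupGL n K).lie) →
          ∀ w ∈ π.W, applyFree (AutomorphyDatum.gl n K hcpt).ofArch p w - c i • w ∈ π.W' := by
  obtain ⟨ι₀, hι₀, g, hgen, hdata⟩ := exists_generators_centerU (K := K) n
  -- the scalar by which `g i` acts, as a function of an enumeration of the archimedean parameter
  have hsc : ∀ i : ι₀, ∃ c : ((K →+* ℂ) → Fin n → ℂ) → ℂ,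
      ∀ (π : AutomorphicRepData (AutomorphyDatum.gl n K hcpt)) (χ : (K →+* ℂ) → Multiset ℂ),
        π.HasArchParameter χ → ∀ L : (K →+* ℂ) → Fin n → ℂ,
          (∀ σ, Finset.univ.val.map (L σ) = χ σ) → ∀ p : FreeAlgebra ℝ (archGroupGL n K).lie,
            freeToEnveloping (archGroupGL n K) p =
              ((g i : centerU (archGroupGL n K)) :
                UniversalEnvelopingAlgebra ℝ (archGroupGL n K).lie) →
            ∀ v ∈ π.W, applyFree (AutomorphyDatum.gl n K hcpt).ofArch p v - c L • v ∈ π.W' := by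
    intro i
    rcases hdata i with ⟨w, z, hz, hg⟩ | ⟨w, z, hz, hg⟩
    · exact ⟨fun L => MvPolynomial.aeval (fun q : (ℝ →ₐ[ℝ] ℂ) × Fin n => L w.1.embedding q.2)
          ((harishChandraHomGL ℝ n).toAlgHom ⟨z, hz⟩),
        fun π χ hχ L hL p hp v hv =>
          applyFree_sub_smul_mem_realPlace π hχ w (hL _) (hp.trans hg) hz hv⟩
    · exact ⟨fun L => MvPolynomial.aeval
          (fun q : (ℂ →ₐ[ℝ] ℂ) × Fin n => L (q.1.toRingHom.comp w.1.embedding) q.2)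
          ((harishChandraHomGL ℂ n).toAlgHom ⟨z, hz⟩),
        fun π χ hχ L hL p hp v hv =>
          applyFree_sub_smul_mem_complexPlace π hχ w (fun τ => hL _) (hp.trans hg) hz hv⟩
  choose scal hscal using hsc
  refine ⟨ι₀, hι₀, g,
    Set.range fun e : (K →+* ℂ) → Fin n → ℤ =>
      fun i => scal i fun σ k => (e σ k : ℂ) + ((n : ℂ) - 1) / 2,
    hgen, Set.countable_range _, fun π hπ => ?_⟩
  obtain ⟨T, ⟨hwf, hχ⟩, hC, -⟩ := hπ
  -- integer enumerations of the `a`-exponents of the (C-algebraic) infinity type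
  have hex : ∀ σ : K →+* ℂ, ∃ e : Fin n → ℤ,
      Finset.univ.val.map (fun k => (e k : ℂ) + ((n : ℂ) - 1) / 2) = (T σ).map ArchWeight.a := by
    intro σ
    refine exists_int_enum (by rw [Multiset.card_map, hwf.1 σ]) _ fun x hx => ?_
    obtain ⟨q, hq, rfl⟩ := Multiset.mem_map.1 hx
    obtain ⟨k, -, hk, -⟩ := hC σ q hq
    exact ⟨k, hk⟩
  choose e he using hex
  exact ⟨_, ⟨e, rfl⟩, fun i p hp v hv =>
    hscal i π _ hχ (fun σ k => (e σ k : ℂ) + ((n : ℂ) - 1) / 2) he p hp v hv⟩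

end Summit.Langlands.Langlands.Theorems.HeckeEigenvalueField.Baire

end
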